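import Literature.NumberTheory.EllipticCurves.CPMuDescentLocal
import HarnessLib

/-!
# Descent values of rational points have trivial torsor class: `[C_{α̂(P)}] = 0` for `P ∈ Ê(K)`
# (Cohen–Pazuki 2009, Prop. 1.4 (2), `Im φ ⊆ Ker α̂`, at the level of `H¹(K, E)`; Silverman X.4.2 (a))

Topic `NumberTheory/EllipticCurves`. Sequel of `CPMuDescentLocal`. For Cohen–Pazuki's curve
`E = cpCurve a b : y² = x³ − 3(ax + b)²` with `μ₃`-kernel datum `T = (0, b√−3)` and torsor classes
`[C_u] = (kernelDatum hb hd).torsorClass hu ∈ H¹(K, E)`, and its isogenous curve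
`Ê = threeTorsionModel m₂ s₂` (`t m₂ = 3a`, `t³ s₂ = 4a³ + 9b`) with descent map
`α̂ = ThreeTorsionDescent.descent Ê m₂ s₂`, this file proves the easy half of the exactness of the
Kummer sequence at `H¹(K, E[φ̂]) = K*/K*³`:

* **`torsorClass_descent_eq_zero`** — `[C_{α̂(P)}] = 0` for every `P ∈ Ê(K)`: the composite
  `Ê(K) → K*/K*³ → H¹(K, E)` vanishes (Cohen–Pazuki: `Im φ ⊆ Ker α̂` dualised; Silverman X.4.2 (a)).
  Proof: a preimage `b₁ ∈ E(K̄)` of `P` under the isogeny (`IsVeluThreePair.pointFun_surjective`) is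
  moved by `σ ∈ Γ_K` inside `b₁ + ⟨T⟩` (its image is rational); the function `g_∓` of
  `CPMuDescentGFunction` has `g(b₁)³ = t³ · (Y ∓ (m₂X + s₂))`, a cube root value `g(b₁) = ω^j ∛v`, and is
  multiplied by `ω^{ck}` under `b₁ ↦ b₁ + kT`; comparing with the Kummer cocycle of `v` shows
  `n_v(σ) T = σ(c b₁ − jT) − (c b₁ − jT)`, a coboundary.
* `torsorClass_eq_zero_of_descent_eq`, `torsorClassQuotHom_descentClass`,
  **`torsorClassQuotHom_eq_one_of_mem_closure`** — `[C_·]` kills the subgroup of `K*/K*³` generated by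
  the descent classes `[α̂(P)]`, `P ∈ Ê(K)`: the input `hS` of the sharp-descent theorem
  `MuThreeKernel.eq_zero_of_mem_sha_of_galH1Map_eq_zero_of_closure`.

## References

* [CohenPazuki2009] H. Cohen, F. Pazuki, Acta Arith. 140 (2009), Definition 1.3, Proposition 1.4 (2).
* [SilvermanAEC2009] J. H. Silverman, *The Arithmetic of Elliptic Curves*, 2nd ed., Thm. X.4.2 (a),
  Prop. X.4.9.
* Templates in the tree: `MordellCurveThreeDescentImage` §2, `MordellCurveThreeDescentLocal`.
-/

noncomputable section

open scoped Classical

open WeierstrassCurve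

universe u

namespace Literature.NumberTheory.EllipticCurves

namespace CPMuDescent

open MordellDescent ThreeTorsionDescent MuThreeKernel

/-! ## Point-level supplement: rational points of `Ê` pull back to the Vélu quotient -/

section PointAlgebra

variable {F : Type u} [Field F] {W W' : WeierstrassCurve F} {a b θ : F}

/-- A point `(X₂, Y₂)` of `Ê = threeTorsionModel m₂ s₂` gives the point `(t²X₂ + 4a², t³Y₂)` of the
Vélu quotient `W'` (undoing the translation by `4a²` and the scaling by `t`).
[cite: CohenPazuki2009, Definition 1.3] -/
theorem equation'_of_scaled (hV : IsVeluThreePair (a * θ) (b * θ) W W') (hθ : θ ^ 2 = -3)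
    {t m₂ s₂ X₂ Y₂ : F} (hm₂ : t * m₂ = 3 * a) (hs₂ : t ^ 3 * s₂ = 4 * a ^ 3 + 9 * b)
    (hE₂ : Y₂ ^ 2 = X₂ ^ 3 + m₂ ^ 2 * X₂ ^ 2 + 2 * m₂ * s₂ * X₂ + s₂ ^ 2) :
    W'.toAffine.Equation (t ^ 2 * X₂ + 4 * a ^ 2) (t ^ 3 * Y₂) := by
  rw [hV.equation'_iff]
  linear_combination (t ^ 6) * hE₂ + (27 * b ^ 2 + 24 * a ^ 3 * b + 16 * a ^ 3 * b * θ ^ 2 - 16 * a ^ 6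
      + 18 * X₂ * a * b * t ^ 2 - 8 * X₂ * a ^ 4 * t ^ 2 - (X₂ ^ 2 * a ^ 2 * t ^ 4)) * hθ
    + (2 * X₂ * t ^ 5 * s₂ + X₂ ^ 2 * t ^ 5 * m₂ + 3 * X₂ ^ 2 * a * t ^ 4) * hm₂
    + (t ^ 3 * s₂ + 9 * b + 4 * a ^ 3 + 6 * X₂ * a * t ^ 2) * hs₂

end PointAlgebra

/-! ## Descent values of `K`-rational points have trivial torsor class -/

section Global

variable {K : Type u} [Field K] [CharZero K]
variable {a b : K} (hb : b ≠ 0) (hd : 4 * a ^ 3 + 9 * b ≠ 0) {t m₂ s₂ : K}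

/-- **The core of `Im φ ⊆ Ker α̂` in `H¹`.** Let `b₁ ∈ E(K̄)` be an affine point which every
`σ ∈ Γ_K` moves inside `b₁ + ⟨T⟩`, and `G ∈ K̄` with `G³ = v ∈ K*` on which `σ` acts through
`ω^{c·k}` whenever `σ b₁ = b₁ + kT`. Then `[C_v] = 0`: writing `G = ω^j ∛v`,
`n_v(σ) = c·k(σ) − (ε(σ) − 1) j`, so the torsor cocycle is the coboundary of `c·b₁ − jT`.
[cite: CohenPazuki2009, Proposition 1.4 (2)] -/
theorem torsorClass_eq_zero_of_moves {v : K} (hv : v ≠ 0) (b₁ : geomPoints (cpCurve a b))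
    (G : AlgebraicClosure K) (hG : G ^ 3 = algebraMap K (AlgebraicClosure K) v) (c : ℕ)
    (hmove : ∀ σ : Field.absoluteGaloisGroup K, ∃ k : ZMod 3,
      σ • b₁ = b₁ + (kernelDatum hb hd).chiT k ∧ galAut σ G = omega K ^ (c * k.val) * G) :
    (kernelDatum hb hd).torsorClass hv = 0 := by
  set 𝒯 := kernelDatum hb hd with h𝒯
  -- `G = ω^j ∛v`
  have hG0 : G ≠ 0 := by
    intro h0; rw [h0, zero_pow three_ne_zero, eq_comm, map_eq_zero] at hG; exact hv hG
  obtain ⟨j, -, hj⟩ : ∃ j < 3, omega K ^ j = G / cubeRoot v := by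
    apply exists_pow_eq_of_pow_three_eq_one K
    rw [div_pow, hG, cubeRoot_pow_three, div_self]
    exact (map_ne_zero_iff _ (algebraMap K (AlgebraicClosure K)).injective).mpr hv
  have hGj : G = omega K ^ j * cubeRoot v := by rw [hj, div_mul_cancel₀ _ (cubeRoot_ne_zero hv)]
  -- the exponent identity `n_v(σ) = c k(σ) − (ε(σ) − 1) j`
  have hexp : ∀ σ : Field.absoluteGaloisGroup K, ∃ k : ZMod 3,
      σ • b₁ = b₁ + 𝒯.chiT k ∧ kummerExp v σ = c * k - (eps σ - 1) * j := by
    intro σ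
    obtain ⟨k, hk, hσG⟩ := hmove σ
    refine ⟨k, hk, ?_⟩
    have h1 : galAut σ G = omega K ^ (epsNat σ * j + (kummerExp v σ).val) * cubeRoot v := by
      rw [hGj, map_mul, galAut_omega_pow, galAut_cubeRoot hv, pow_add]; ring
    rw [hGj] at hσG h1
    have h2 : omega K ^ (c * k.val) * (omega K ^ j * cubeRoot v) = omega K ^ (c * k.val + j) * cubeRoot v := by
      rw [pow_add]; ring
    rw [h2] at hσG
    have h3 := natCast_eq_of_omega_pow_mul_cubeRoot_eq hv (hσG.symm.trans h1)
    push_cast at h3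
    rw [epsNat_cast, ZMod.natCast_zmod_val, ZMod.natCast_zmod_val] at h3
    linear_combination -h3
  -- the cocycle is the coboundary of `c b₁ − jT`
  unfold MuThreeKernel.torsorClass
  rw [GaloisRepresentations.oneCocycleClass_eq_zero_iff]
  refine ⟨c • b₁ - 𝒯.chiT j, fun σ => ?_⟩
  change 𝒯.torsorFun v σ = σ • (c • b₁ - 𝒯.chiT j) - (c • b₁ - 𝒯.chiT j)
  obtain ⟨k, hk, hn⟩ := hexp σ
  have hσc : σ • (c • b₁) = c • b₁ + c • 𝒯.chiT k := by
    rw [show σ • (c • b₁) = c • (σ • b₁) from map_nsmul (DistribSMul.toAddMonoidHom _ σ) c b₁, hk,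
      smul_add]
  rw [MuThreeKernel.torsorFun, hn, map_sub, ← nsmul_eq_mul, map_nsmul, 𝒯.chiT_eps_sub_one_mul, smul_sub,
    hσc]
  abel

/-- **`[C_{α̂(P)}] = 0` for every `K`-rational point `P` of `Ê = threeTorsionModel m₂ s₂`**
(`t m₂ = 3a`, `t³ s₂ = 4a³ + 9b`): the composite `Ê(K) → K*/K*³ → H¹(K, E)` of the Kummer sequence of
the `3`-isogeny `φ̂ : E → Ê` vanishes — Cohen–Pazuki's `Im ⊆ Ker` half of Proposition 1.4 (2), read in
`H¹(K, E)`. [cite: CohenPazuki2009, Proposition 1.4 (2)] [cite: SilvermanAEC2009, Thm. X.4.2 (a)] -/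
theorem torsorClass_descent_eq_zero (ht : t ≠ 0) (hm₂ : t * m₂ = 3 * a)
    (hs₂ : t ^ 3 * s₂ = 4 * a ^ 3 + 9 * b) (P : (threeTorsionModel m₂ s₂).toAffine.Point)
    (hne : descent (threeTorsionModel m₂ s₂) m₂ s₂ P ≠ 0) :
    (kernelDatum hb hd).torsorClass hne = 0 := by
  set 𝒯 := kernelDatum hb hd with h𝒯
  have hV := isVeluThreePair_geom hb hd
  have hθ := theta_sq K
  set L := AlgebraicClosure K with hL
  set ι := algebraMap K L with hι
  have hιinj : Function.Injective ι := (algebraMap K L).injective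
  have hs0 : s₂ ≠ 0 := by
    intro h0; rw [h0, mul_zero] at hs₂; exact hd hs₂.symm
  have h2s : (2 : K) * s₂ ≠ 0 := mul_ne_zero two_ne_zero hs0
  rcases P with _ | ⟨X₂, Y₂, hP⟩
  · -- `α̂(O) = 1`
    exact 𝒯.torsorClass_of_eq_cube _ 1 (by rw [← Affine.Point.zero_def, descent_zero]; ring)
  · -- a `K̄`-preimage `b₁` of `(t²X₂ + 4a², t³Y₂) ∈ W'(K̄)`
    have hE₂ : Y₂ ^ 2 = X₂ ^ 3 + m₂ ^ 2 * X₂ ^ 2 + 2 * m₂ * s₂ * X₂ + s₂ ^ 2 :=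
      (ThreeTorsionDescent.equation_iff_of_eq rfl X₂ Y₂).mp hP.left
    have hE₂' : ι Y₂ ^ 2 = ι X₂ ^ 3 + ι m₂ ^ 2 * ι X₂ ^ 2 + 2 * ι m₂ * ι s₂ * ι X₂ + ι s₂ ^ 2 := by
      have := congrArg ι hE₂; simpa only [map_pow, map_add, map_mul, map_ofNat] using this
    have hm₂' : ι t * ι m₂ = 3 * ι a := by rw [← map_mul, hm₂, map_mul, map_ofNat]
    have hs₂' : ι t ^ 3 * ι s₂ = 4 * ι a ^ 3 + 9 * ι b := by
      rw [← map_pow, ← map_mul, hs₂]; simp only [map_add, map_mul, map_pow, map_ofNat]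
    have hEq' := equation'_of_scaled hV hθ hm₂' hs₂' hE₂'
    have hns' := (Affine.equation_iff_nonsingular_of_Δ_ne_zero hV.Δ'_ne).mp hEq'
    obtain ⟨b₁, hb₁⟩ := hV.pointFun_surjective (Affine.Point.some _ _ hns')
    -- `b₁` is affine with `x ≠ 0`
    rcases b₁ with _ | ⟨xb, yb, hxyb⟩
    · rw [← Affine.Point.zero_def, hV.pointFun_zero] at hb₁
      exact absurd hb₁.symm (Affine.Point.some_ne_zero _)
    have hxb : xb ≠ 0 := by
      intro h0; rw [hV.pointFun_some_of_eq_zero _ h0] at hb₁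
      exact absurd hb₁.symm (Affine.Point.some_ne_zero _)
    rw [hV.pointFun_some _ hxb] at hb₁
    obtain ⟨hXb, hYb⟩ := Affine.Point.some.inj hb₁
    set b₁ : geomPoints (cpCurve a b) := Affine.Point.some xb yb hxyb with hbdef
    -- `Γ_K` moves `b₁` inside `b₁ + ⟨T⟩`, acting on `g±(b₁)` through `ω^{k}`, `ω^{2k}`
    have hfix : ∀ (σ : Field.absoluteGaloisGroup K) (r : K), galAut σ (ι r) = ι r :=
      fun σ r => AlgEquiv.commutes (galAut σ) r
    have hXform : ∀ x : L, hV.X x = (x ^ 3 - 12 * ι a * ι b * x - 12 * ι b ^ 2) / x ^ 2 :=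
      fun x => X_eq' hV hθ x
    have hYform : ∀ x y : L, hV.Y x y = y * (x ^ 3 + 12 * ι a * ι b * x + 24 * ι b ^ 2) / x ^ 3 :=
      fun x y => Y_eq' hV hθ x y
    have hmove : ∀ σ : Field.absoluteGaloisGroup K, ∃ k : ZMod 3, σ • b₁ = b₁ + 𝒯.chiT k ∧
        galAut σ (gFun (ι a) (ι b) b₁) = omega K ^ (1 * k.val) * gFun (ι a) (ι b) b₁ ∧
        galAut σ (gFun (-ι a) (-ι b) b₁) = omega K ^ (2 * k.val) * gFun (-ι a) (-ι b) b₁ := by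
      intro σ
      have hσb : σ • b₁ = Affine.Point.some (galAut σ xb) (galAut σ yb) (nonsingular_galAut σ hxyb) :=
        smul_geomPoints_some σ hxyb (nonsingular_galAut σ hxyb)
      have hσx : galAut σ xb ≠ 0 := fun h0 => hxb (by simpa using congrArg (galAut σ).symm h0)
      -- the image of `σ b₁` is that of `b₁`
      have hφ : hV.pointFun (σ • b₁) = hV.pointFun b₁ := by
        rw [hσb, hV.pointFun_some _ hσx, hbdef, hV.pointFun_some _ hxb]
        have hX : galAut σ (hV.X xb) = hV.X (galAut σ xb) := by
          rw [hXform xb, hXform (galAut σ xb)]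
          simp only [map_div₀, map_sub, map_pow, map_mul, map_ofNat, hfix]
        have hY : galAut σ (hV.Y xb yb) = hV.Y (galAut σ xb) (galAut σ yb) := by
          rw [hYform xb yb, hYform (galAut σ xb) (galAut σ yb)]
          simp only [map_div₀, map_add, map_pow, map_mul, map_ofNat, hfix]
        have hX' : hV.X (galAut σ xb) = hV.X xb := by
          rw [← hX, hXb]; simp only [map_add, map_mul, map_pow, map_ofNat, hfix]
        have hY' : hV.Y (galAut σ xb) (galAut σ yb) = hV.Y xb yb := by
          rw [← hY, hYb]; simp only [map_mul, map_pow, hfix]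
        exact point_some_ext hX' hY'
      -- the difference `σ b₁ − b₁`, computed in `E(K̄)` = the points of the base change
      set d : ((cpCurve a b).baseChange L).toAffine.Point := σ • b₁ - b₁ with hd'
      have hker : hV.pointFun d = 0 := by
        have e : hV.pointHom (σ • b₁) - hV.pointHom b₁ = 0 := by
          rw [hV.pointHom_apply, hV.pointHom_apply, hφ, sub_self]
        rw [← map_sub] at e
        exact e
      rw [hV.pointFun_eq_zero_iff] at hker
      obtain ⟨k, hk⟩ := 𝒯.exists_chiT_eq (P := d) hker
      have hσb' : σ • b₁ = b₁ + 𝒯.chiT k := by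
        have : σ • b₁ - b₁ = 𝒯.chiT k := hk.symm
        rw [← this]; abel
      have hkT : 𝒯.chiT k = k.val • hV.T := 𝒯.chiT_eq_val_nsmul k
      have hPt : b₁ + 𝒯.chiT k =
          (show ((cpCurve a b).baseChange L).toAffine.Point from b₁) + k.val • hV.T := by
        rw [hkT]; rfl
      refine ⟨k, hσb', ?_, ?_⟩
      · have h1 : galAut σ (gFun (ι a) (ι b) b₁) = gFun (ι a) (ι b) (σ • b₁) := by
          rw [hσb, hbdef, gFun_some, gFun_some]
          simp only [map_div₀, map_add, map_mul, map_ofNat, hfix]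
        rw [h1, hσb', hPt, gFun_add_nsmul_T hV hθ _ k.val, one_mul]
        rfl
      · have h1 : galAut σ (gFun (-ι a) (-ι b) b₁) = gFun (-ι a) (-ι b) (σ • b₁) := by
          rw [hσb, hbdef, gFun_some, gFun_some]
          simp only [map_div₀, map_add, map_mul, map_neg, map_ofNat, hfix]
        rw [h1, hσb', hPt, gFun_neg_add_nsmul_T hV hθ _ k.val, ← omega_sq, ← pow_mul]
    -- the cubes of `g±(b₁)`: `t³ (Y₂ ± (m₂ X₂ + s₂))`
    have hgm3 : gFun (-ι a) (-ι b) b₁ ^ 3 = ι (t ^ 3 * (Y₂ - m₂ * X₂ - s₂)) := by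
      rw [hbdef, gFun_neg_pow_three hV hθ hxyb hxb, hXb, hYb]
      have e : t ^ 3 * (Y₂ - m₂ * X₂ - s₂) = t ^ 3 * Y₂ - 3 * a * (t ^ 2 * X₂ + 4 * a ^ 2 - 4 * a ^ 2)
          - (4 * a ^ 3 + 9 * b) := by
        rw [← hs₂]; linear_combination (-(t ^ 2 * X₂)) * hm₂
      rw [e]; simp only [map_sub, map_add, map_mul, map_pow, map_ofNat]
    have hgp3 : gFun (ι a) (ι b) b₁ ^ 3 = ι (t ^ 3 * (Y₂ + m₂ * X₂ + s₂)) := by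
      rw [hbdef, gFun_pow_three hV hθ hxyb hxb, hXb, hYb]
      have e : t ^ 3 * (Y₂ + m₂ * X₂ + s₂) = t ^ 3 * Y₂ + 3 * a * (t ^ 2 * X₂ + 4 * a ^ 2 - 4 * a ^ 2)
          + (4 * a ^ 3 + 9 * b) := by
        rw [← hs₂]; linear_combination (t ^ 2 * X₂) * hm₂
      rw [e]; simp only [map_sub, map_add, map_mul, map_pow, map_ofNat]
    by_cases hδ : Y₂ - m₂ * X₂ - s₂ = 0
    · -- `P = T₂ = (0, s₂)`: `α̂(P) = (2s₂)²`, and `[C_{2s₂}] = 0` through `g₊`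
      obtain ⟨hX0, hYs⟩ := (ThreeTorsionDescent.sub_eq_zero_iff rfl hP.left).mp hδ
      have hv' : t ^ 3 * (Y₂ + m₂ * X₂ + s₂) = t ^ 3 * (2 * s₂) := by rw [hX0, hYs]; ring
      have hv : t ^ 3 * (2 * s₂) ≠ 0 := mul_ne_zero (pow_ne_zero 3 ht) h2s
      rw [hv'] at hgp3
      have hC : 𝒯.torsorClass hv = 0 :=
        torsorClass_eq_zero_of_moves hb hd hv b₁ _ hgp3 1 fun σ => by
          obtain ⟨k, hk, hp, -⟩ := hmove σ; exact ⟨k, hk, hp⟩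
      -- `α̂(T₂) = (2s₂)² = (t³ · 2 s₂)² · (t⁻²)³`
      have e : (2 * s₂) ^ 2 = (t ^ 3 * (2 * s₂)) * (t ^ 3 * (2 * s₂)) * (t⁻¹ ^ 2) ^ 3 := by
        field_simp
      have hcl : cubeClass (descent (threeTorsionModel m₂ s₂) m₂ s₂ (Affine.Point.some X₂ Y₂ hP)) =
          cubeClass ((t ^ 3 * (2 * s₂)) * (t ^ 3 * (2 * s₂))) := by
        rw [descent_some_of_eq _ _ _ hδ, e, cubeClass_mul_pow_three (mul_ne_zero hv hv)
          (pow_ne_zero 2 (inv_ne_zero ht))]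
      rw [𝒯.torsorClass_eq_of_cubeClass_eq hne (mul_ne_zero hv hv) hcl, 𝒯.torsorClass_mul hv hv, hC,
        add_zero]
    · -- generic `P`: `α̂(P) = Y₂ − m₂X₂ − s₂ = t³(…) · (t⁻¹)³`, `[C] = 0` through `g₋`
      have hv : t ^ 3 * (Y₂ - m₂ * X₂ - s₂) ≠ 0 := mul_ne_zero (pow_ne_zero 3 ht) hδ
      have hC : 𝒯.torsorClass hv = 0 :=
        torsorClass_eq_zero_of_moves hb hd hv b₁ _ hgm3 2 fun σ => by
          obtain ⟨k, hk, -, hm⟩ := hmove σ; exact ⟨k, hk, hm⟩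
      have e : Y₂ - m₂ * X₂ - s₂ = (t ^ 3 * (Y₂ - m₂ * X₂ - s₂)) * t⁻¹ ^ 3 := by
        field_simp
      have hcl : cubeClass (descent (threeTorsionModel m₂ s₂) m₂ s₂ (Affine.Point.some X₂ Y₂ hP)) =
          cubeClass (t ^ 3 * (Y₂ - m₂ * X₂ - s₂)) := by
        rw [descent_some_of_ne _ _ _ hδ]
        conv_lhs => rw [e]
        rw [cubeClass_mul_pow_three hv (inv_ne_zero ht)]
      rw [𝒯.torsorClass_eq_of_cubeClass_eq hne hv hcl, hC]

/-- **`u ∈ α̂(Ê(K)) · K*³ ⟹ [C_u] = 0`.** [cite: CohenPazuki2009, Proposition 1.4 (2)] -/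
theorem torsorClass_eq_zero_of_descent_eq (ht : t ≠ 0) (hm₂ : t * m₂ = 3 * a)
    (hs₂ : t ^ 3 * s₂ = 4 * a ^ 3 + 9 * b) {u : K} (hu : u ≠ 0)
    (h : ∃ (P : (threeTorsionModel m₂ s₂).toAffine.Point) (w : K), w ≠ 0 ∧
      descent (threeTorsionModel m₂ s₂) m₂ s₂ P = u * w ^ 3) :
    (kernelDatum hb hd).torsorClass hu = 0 := by
  obtain ⟨P, w, hw, hP⟩ := h
  have hne : descent (threeTorsionModel m₂ s₂) m₂ s₂ P ≠ 0 := by rw [hP]; exact mul_ne_zero hu (pow_ne_zero 3 hw)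
  have hcl : cubeClass u = cubeClass (descent (threeTorsionModel m₂ s₂) m₂ s₂ P) := by
    rw [hP, cubeClass_mul_pow_three hu hw]
  rw [(kernelDatum hb hd).torsorClass_eq_of_cubeClass_eq hu hne hcl]
  exact torsorClass_descent_eq_zero hb hd ht hm₂ hs₂ P hne

/-- Multiplicative-class form: `[α̂(P)] ∈ ker([a] ↦ [C_a])` for `P ∈ Ê(K)`.
[cite: CohenPazuki2009, Proposition 1.4 (2)] -/
theorem torsorClassQuotHom_descentClass (ht : t ≠ 0) (hm₂ : t * m₂ = 3 * a)
    (hs₂ : t ^ 3 * s₂ = 4 * a ^ 3 + 9 * b) (P : (threeTorsionModel m₂ s₂).toAffine.Point) :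
    (kernelDatum hb hd).torsorClassQuotHom (descentClass (threeTorsionModel m₂ s₂) m₂ s₂ P) = 1 := by
  have hs0 : s₂ ≠ 0 := by
    intro h0; rw [h0, mul_zero] at hs₂; exact hd hs₂.symm
  have hne := descent_ne_zero (W := threeTorsionModel m₂ s₂) (m := m₂) (mul_ne_zero two_ne_zero hs0) P
  rw [descentClass, (kernelDatum hb hd).torsorClassQuotHom_cubeClass hne,
    torsorClass_descent_eq_zero hb hd ht hm₂ hs₂ P hne]
  rfl

/-- **`[C_·]` kills the subgroup of `K*/K*³` generated by the descent classes of rational points of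
`Ê`** — the hypothesis `hS` of `MuThreeKernel.eq_zero_of_mem_sha_of_galH1Map_eq_zero_of_closure` for
Cohen–Pazuki's `μ₃`-descent: a sharp `α̂`-Selmer group (filled by rational points) gives
`Ш(E/K) ∩ ker φ̂_* = 0`. [cite: CohenPazuki2009, Proposition 1.4 (2)] [cite: SilvermanAEC2009, Thm. X.4.2 (a)] -/
theorem torsorClassQuotHom_eq_one_of_mem_closure (ht : t ≠ 0) (hm₂ : t * m₂ = 3 * a)
    (hs₂ : t ^ 3 * s₂ = 4 * a ^ 3 + 9 * b) {x : CubeUnits K}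
    (hx : x ∈ Subgroup.closure
      (Set.range fun P : (threeTorsionModel m₂ s₂).toAffine.Point =>
        descentClass (threeTorsionModel m₂ s₂) m₂ s₂ P)) :
    (kernelDatum hb hd).torsorClassQuotHom x = 1 := by
  rw [← MonoidHom.mem_ker]
  refine (Subgroup.closure_le _).mpr ?_ hx
  rintro _ ⟨P, rfl⟩
  exact (MonoidHom.mem_ker).mpr (torsorClassQuotHom_descentClass hb hd ht hm₂ hs₂ P)

end Global

end CPMuDescent

end Literature.NumberTheory.EllipticCurves

end
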